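import Mathlib
import HarnessLib

/-!
# Abel summation on a window against a `c log t + O(K)` counting function

Topic `Literature/NumberTheory/LFunctions/Zhang2022` (Landau–Siegel audit tree; verdict-neutral;
campaign siegel-zhang, L3 LEDGER #11 "range-average engine", part 1/3 — a generic tool, no DAG node).
For Y. Zhang, arXiv:2211.02515v1 [Zhang2022LandauSiegel], §8 (8.11) and every "second line" of the
§10 range evaluations (pp. 57–61), the manuscript passes from a weighted sum over a window
`P^a ≤ n < P^b` to `𝔠_D∫ G(t)dt/t` "by partial integration" against the mean value
`Σ_{n<x}|χ(n)|φ(n)n⁻² = 𝔠_D log x + O(log 𝓛)`. This file isolates the partial summation: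

* `norm_sum_Ioc_mul_sub_integral_le` — for `b : ℕ → ℝ` with `|Σ_{k≤t} b(k) − c log t| ≤ K` on
  `[lo, hi]` (`1 ≤ lo ≤ hi`) and `F : ℝ → ℂ` differentiable on `[lo, hi]` with `‖F‖ ≤ M`,
  `‖F′(t)‖ ≤ M′/t`: `‖Σ_{lo<k≤hi} F(k)b(k) − c∫_{lo}^{hi} F(t)dt/t‖ ≤ K(2M + M′ log(hi/lo))`
  (Mathlib's `sum_mul_eq_sub_sub_integral_mul` plus one integration by parts; the window sibling of
  `Section8AbelProfiles.norm_sum_mul_sub_integral_le`, which is the case `lo = 1`).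

Parts 2/3 (`Section10RangeAverage.lean`: the rule for `Typed.Sec10B.nAvg`) and 3/3
(`Section10RangeSecondLine.lean`: `x = P^z` and the `𝔞 = 𝔠_D L′(1,χ)²` packaging) build on it.

## References

* H. L. Montgomery, R. C. Vaughan, *Multiplicative Number Theory I*, CUP 2007, Thm. 4.2 (Abel
  summation). [cite: MontgomeryVaughan2007, Thm. 4.2]
* Y. Zhang, arXiv:2211.02515v1 (2022), §8 (8.11) p. 48 ("by partial integration").
  [cite: Zhang2022LandauSiegel, §8 (8.11) p. 48]
-/

noncomputable section

open Complex Real MeasureTheory Set Finset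

namespace Literature.NumberTheory.LFunctions.Zhang2022.RangeAverage

/-- **Abel summation on a window.** Let `b : ℕ → ℝ` with counting function
`Σ_{k≤t} b(k) = c log t + R(t)`, `|R(t)| ≤ K` on `[lo, hi]` (`1 ≤ lo ≤ hi`), and let `F` be
differentiable on `[lo, hi]` with `‖F‖ ≤ M`, `‖F′(t)‖ ≤ M′/t` there. Then
`‖Σ_{lo<k≤hi} F(k)b(k) − c∫_{lo}^{hi} F(t)dt/t‖ ≤ K(2M + M′ log(hi/lo))`
(Mathlib's `sum_mul_eq_sub_sub_integral_mul` and one integration by parts).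
[cite: MontgomeryVaughan2007, Thm. 4.2] -/
theorem norm_sum_Ioc_mul_sub_integral_le {b : ℕ → ℝ} {F : ℝ → ℂ} {lo hi c K M M' : ℝ}
    (hlo : 1 ≤ lo) (hlohi : lo ≤ hi) (hM' : 0 ≤ M')
    (hR : ∀ t ∈ Set.Icc lo hi, |(∑ k ∈ Finset.Icc 0 ⌊t⌋₊, b k) - c * Real.log t| ≤ K)
    (hFd : ∀ t ∈ Set.Icc lo hi, DifferentiableAt ℝ F t)
    (hF : ∀ t ∈ Set.Icc lo hi, ‖F t‖ ≤ M) (hF' : ∀ t ∈ Set.Icc lo hi, ‖deriv F t‖ ≤ M' / t) :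
    ‖(∑ k ∈ Finset.Ioc ⌊lo⌋₊ ⌊hi⌋₊, F k * (b k : ℂ)) - c * ∫ t in lo..hi, F t / t‖ ≤
      K * (2 * M + M' * Real.log (hi / lo)) := by
  have hlo0 : 0 < lo := by linarith
  have hhi0 : 0 < hi := by linarith
  have hK : 0 ≤ K := le_trans (abs_nonneg _) (hR lo ⟨le_rfl, hlohi⟩)
  have hM : 0 ≤ M := le_trans (norm_nonneg _) (hF lo ⟨le_rfl, hlohi⟩)
  set cc : ℕ → ℂ := fun k => (b k : ℂ) with hcc
  set F' : ℝ → ℂ := deriv F with hF'def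
  have hFd' : ∀ t ∈ Set.Icc lo hi, HasDerivAt F (F' t) t := fun t ht => (hFd t ht).hasDerivAt
  -- `F′` is integrable on `[lo, hi]`: measurable (a derivative) and bounded by `M′/lo`
  have hmeas : AEStronglyMeasurable F' volume := (measurable_deriv F).aestronglyMeasurable
  have hbd : ∀ᵐ t ∂(volume.restrict (Set.Icc lo hi)), ‖F' t‖ ≤ M' / lo := by
    rw [ae_restrict_iff' measurableSet_Icc]
    refine ae_of_all _ fun t ht => (hF' t ht).trans ?_
    exact div_le_div_of_nonneg_left hM' hlo0 ht.1
  have hint : IntegrableOn F' (Set.Icc lo hi) :=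
    Measure.integrableOn_of_bounded measure_Icc_lt_top.ne hmeas hbd
  have abel := sum_mul_eq_sub_sub_integral_mul cc hlo0.le hlohi hFd hint
  -- the counting function and its remainder
  set C : ℝ → ℂ := fun t => ∑ k ∈ Finset.Icc 0 ⌊t⌋₊, cc k with hC
  have hCreal : ∀ t, C t = ((∑ k ∈ Finset.Icc 0 ⌊t⌋₊, b k : ℝ) : ℂ) := by
    intro t; simp [hC, hcc]
  have hRC : ∀ t ∈ Set.Icc lo hi, ‖C t - c * Real.log t‖ ≤ K := by
    intro t ht
    rw [hCreal, ← Complex.ofReal_mul, ← Complex.ofReal_sub, Complex.norm_real, Real.norm_eq_abs]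
    exact hR t ht
  have hne : ∀ t ∈ Set.Icc lo hi, t ≠ 0 := fun t ht => by linarith [ht.1]
  -- integrability facts
  have hF'C : IntervalIntegrable (fun t => F' t * C t) volume lo hi := by
    rw [intervalIntegrable_iff_integrableOn_Icc_of_le hlohi]
    exact integrableOn_mul_sum_Icc cc hlo0.le hint
  have hlogc : ContinuousOn (fun t : ℝ => (c : ℂ) * (Real.log t : ℂ)) (Set.Icc lo hi) :=
    continuousOn_const.mul (Complex.continuous_ofReal.comp_continuousOn
      (Real.continuousOn_log.mono fun t ht => by
        simp only [Set.mem_compl_iff, Set.mem_singleton_iff]; exact hne t ht))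
  have hF'log : IntervalIntegrable (fun t => F' t * ((c : ℂ) * (Real.log t : ℂ))) volume lo hi := by
    rw [intervalIntegrable_iff_integrableOn_Icc_of_le hlohi]
    exact hint.mul_continuousOn hlogc isCompact_Icc
  have hinvc : ContinuousOn (fun t : ℝ => ((c : ℂ) / (t : ℂ))) (Set.Icc lo hi) :=
    continuousOn_const.div (Complex.continuous_ofReal.continuousOn)
      (fun t ht => by exact_mod_cast hne t ht)
  -- integration by parts: `c∫ F/t = F(hi)c log hi − F(lo)c log lo − ∫ F′·c log`
  have hlogd : ∀ t ∈ Set.uIcc lo hi, HasDerivAt (fun t : ℝ => (c : ℂ) * (Real.log t : ℂ))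
      ((c : ℂ) / (t : ℂ)) t := by
    intro t ht
    rw [Set.uIcc_of_le hlohi] at ht
    have h1 : HasDerivAt (fun t : ℝ => (Real.log t : ℂ)) ((t⁻¹ : ℝ) : ℂ) t :=
      (Real.hasDerivAt_log (hne t ht)).ofReal_comp
    refine (h1.const_mul (c : ℂ)).congr_deriv ?_
    push_cast
    rw [div_eq_mul_inv]
  have ibp := intervalIntegral.integral_mul_deriv_eq_deriv_mul
    (fun t ht => hFd' t (by rwa [Set.uIcc_of_le hlohi] at ht)) hlogd
    ((intervalIntegrable_iff_integrableOn_Icc_of_le hlohi).mpr hint)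
    (hinvc.intervalIntegrable_of_Icc hlohi)
  have eI : (c : ℂ) * ∫ t in lo..hi, F t / t = ∫ t in lo..hi, F t * ((c : ℂ) / (t : ℂ)) := by
    rw [← intervalIntegral.integral_const_mul]
    congr 1; funext t; ring
  have eA : ∫ t in Set.Ioc lo hi, deriv F t * C t = ∫ t in lo..hi, F' t * C t := by
    rw [intervalIntegral.integral_of_le hlohi]
  -- assemble
  have key : (∑ k ∈ Finset.Ioc ⌊lo⌋₊ ⌊hi⌋₊, F k * (b k : ℂ)) - c * ∫ t in lo..hi, F t / t =
      F hi * (C hi - c * Real.log hi) - F lo * (C lo - c * Real.log lo) -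
        ∫ t in lo..hi, F' t * (C t - c * Real.log t) := by
    have e1 : (∑ k ∈ Finset.Ioc ⌊lo⌋₊ ⌊hi⌋₊, F k * (b k : ℂ)) =
        F hi * C hi - F lo * C lo - ∫ t in lo..hi, F' t * C t := by
      rw [← eA]; exact abel
    rw [e1, eI, ibp]
    have e2 : ∫ t in lo..hi, F' t * (C t - c * Real.log t) =
        (∫ t in lo..hi, F' t * C t) - ∫ t in lo..hi, F' t * ((c : ℂ) * (Real.log t : ℂ)) := by
      rw [← intervalIntegral.integral_sub hF'C hF'log]
      congr 1; funext t; ring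
    rw [e2]
    ring
  rw [key]
  have hhimem : hi ∈ Set.Icc lo hi := ⟨hlohi, le_rfl⟩
  have hlomem : lo ∈ Set.Icc lo hi := ⟨le_rfl, hlohi⟩
  have n1 : ‖F hi * (C hi - c * Real.log hi)‖ ≤ M * K := by
    rw [norm_mul]
    exact mul_le_mul (hF hi hhimem) (hRC hi hhimem) (norm_nonneg _) hM
  have n1' : ‖F lo * (C lo - c * Real.log lo)‖ ≤ M * K := by
    rw [norm_mul]
    exact mul_le_mul (hF lo hlomem) (hRC lo hlomem) (norm_nonneg _) hM
  have n2 : ‖∫ t in lo..hi, F' t * (C t - c * Real.log t)‖ ≤ ∫ t in lo..hi, M' * K / t := by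
    refine intervalIntegral.norm_integral_le_of_norm_le hlohi ?_ ?_
    · filter_upwards with t ht
      have ht' : t ∈ Set.Icc lo hi := ⟨ht.1.le, ht.2⟩
      have ht0 : 0 < t := by linarith [ht.1]
      rw [norm_mul]
      calc ‖F' t‖ * ‖C t - c * Real.log t‖ ≤ M' / t * K :=
            mul_le_mul (hF' t ht') (hRC t ht') (norm_nonneg _) (by positivity)
        _ = M' * K / t := by ring
    · exact (continuousOn_const.div continuousOn_id fun t ht => by
        rw [Set.uIcc_of_le hlohi] at ht; exact hne t ht).intervalIntegrable
  have n3 : ∫ t in lo..hi, M' * K / t = M' * K * Real.log (hi / lo) := by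
    have e : (fun t : ℝ => M' * K / t) = fun t => M' * K * t⁻¹ := by funext t; ring
    rw [e, intervalIntegral.integral_const_mul, integral_inv (by
      rw [Set.uIcc_of_le hlohi]; intro h; exact absurd h.1 (by linarith))]
  calc ‖F hi * (C hi - c * Real.log hi) - F lo * (C lo - c * Real.log lo) -
        ∫ t in lo..hi, F' t * (C t - c * Real.log t)‖
      ≤ ‖F hi * (C hi - c * Real.log hi)‖ + ‖F lo * (C lo - c * Real.log lo)‖ +
          ‖∫ t in lo..hi, F' t * (C t - c * Real.log t)‖ := norm_sub_le_of_le (norm_sub_le _ _) le_rfl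
    _ ≤ M * K + M * K + M' * K * Real.log (hi / lo) := add_le_add (add_le_add n1 n1') (n2.trans n3.le)
    _ = K * (2 * M + M' * Real.log (hi / lo)) := by ring


end Literature.NumberTheory.LFunctions.Zhang2022.RangeAverage
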